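import Summits.MatrixMultiplication.OmegaCensus.ThreeSetLineInverseCertificate
import HarnessLib

/-!
# Inverse certificates for the three-set line identity — PACKED arithmetic (≈ 3–5× faster kernel check)

ω-census `pub-omega`, family (b3), seat pub-omega-group gen 39.  Framing: lottery ticket; floor = certified bounds/negative
ranges.  VALUE: a faster variant of the kernel tool `LineInv.noSol3Chk` (`ThreeSetLineInverseCertificate`) for the three-set cube
cells over `ℤ_p²` (next: `(4,5,6)@361`, `(4,4,11)@529`, the `|W| = 4` cells of `841`, `961`); NOT progress on ω.

Measured on the gate farm (gen 39): in `noSol3Chk` the kernel time is dominated by list recursion (≈ 5–10 µs per step) and by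
re-forcing of thunks stored in nested lists, NOT by arithmetic.  Here every vector that is read more than once is stored as ONE natural
number in base `X = 2^b` (`enc`), read back by `digit` (three bignum operations, GMP-accelerated in the kernel):
* the symbols `A, C` of the line matrix are packed once (`pA, pC`); the packed ROWS `RP r = enc (row r of M)` are built from their digits;
* the candidate inverse is computed entirely in packed form (`invCandP`: DFT by middle-digit products with the constant table `ZR`,
  rows of `B` by bignum rotations) — UNVERIFIED, as before only the check matters;
* the check `B·M ≡ I (mod N)` is done row-wise: `S_i = Σ_r B(i,r)·RP r` is the packed row `i` of `B·M` (no carries under the bound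
  `q·N·(3·ΣW·ΣF) < X`, checked), and its digits are compared with `δ_i` (`invChkQ`);
* holes as in `noSol3Chk`, reading `B(i,s)` as digits of the packed rows (`holeRefutedP`).
`noSol3ChkQ_sound`: the same statement as `noSol3Chk_sound`.  Lemmas: `digit_enc` (digits of a packed small-entry list),
`enc_map_add/smul/sum` (packing is linear), `getD_le_sum`.
-/

namespace Summit.MatrixMultiplication.OmegaCensus

open Finset

namespace LineInv

/-! ## Packed arithmetic -/

/-- Little-endian packing of a list in base `X`: `enc X [a₀, a₁, …] = a₀ + X·(a₁ + X·(…))`. [folklore] -/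
def enc (X : ℕ) : List ℕ → ℕ
  | [] => 0
  | a :: l => a + X * enc X l

/-- Digit `j` of `n` in base `X`. [folklore] -/
def digit (X n j : ℕ) : ℕ := n / X ^ j % X

/-- Middle-digit product: for `P = Σ_{u<q} v_u X^u` and `R = Σ_{u<q} c_{q-1-u} X^u`, digit `q − 1` of `P·R` is `Σ v_u c_u` (no carries).
Used only in the UNVERIFIED candidate. [folklore] -/
def pdot (q X P R : ℕ) : ℕ := P * R / X ^ (q - 1) % X

/-- Packed DFT row constants `ZR k = enc (reverse [ζ^{ku} mod N]_u)`. [folklore] -/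
def zrows (q N ζ X : ℕ) : List ℕ :=
  (List.range q).map fun k => enc X (((List.range q).map fun u => ζ ^ (k * u % q) % N).reverse)

/-- Packed rows of the line matrix from the packed symbols: `RP r = enc [digit pA (r−j) + digit pC (r+j)]_j`. [folklore] -/
def rowpacksD (q X pA pC : ℕ) : List ℕ :=
  (List.range q).map fun r => enc X ((List.range q).map fun j => digit X pA ((r + q - j) % q) + digit X pC ((r + j) % q))

/-- UNVERIFIED packed candidate inverse mod `N`: the `q` packed rows `β_i = Σ_r B(i,r) X^r` (digits `< 2N`; read mod `N`). [folklore] -/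
def invCandP (q N X : ℕ) (ZR : List ℕ) (W F : List ℕ) : List ℕ :=
  let pw := enc X W
  let px := enc X F
  let wh := (List.range q).map fun k => pdot q X pw (ZR.getD k 0) % N
  let xh := (List.range q).map fun k => pdot q X px (ZR.getD k 0) % N
  let neg := fun k : ℕ => (q - k) % q
  let Ah := (List.range q).map fun k => (wh.getD (neg k) 0 * xh.getD k 0 + wh.getD k 0 * xh.getD (neg k) 0) % N
  let Ch := (List.range q).map fun k => (wh.getD k 0 * xh.getD k 0) % N
  let dt := fun k : ℕ => (Ah.getD k 0 * Ah.getD (neg k) 0 + N * N - Ch.getD k 0 * Ch.getD (neg k) 0) % N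
  let Ap := (List.range q).map fun k =>
    if k = 0 then invN N ((Ah.getD 0 0 + Ch.getD 0 0) % N) else (Ah.getD (neg k) 0 * invN N (dt k)) % N
  let Cp := (List.range q).map fun k => if k = 0 then 0 else ((N - Ch.getD k 0) * invN N (dt k)) % N
  let qi := invN N (q % N)
  let pAp := enc X Ap
  let pCp := enc X Cp
  let Apr := (List.range q).map fun t => qi * pdot q X pAp (ZR.getD (neg t) 0) % N
  let Cpr := (List.range q).map fun t => qi * pdot q X pCp (ZR.getD (neg t) 0) % N
  let a0 := enc X ((List.range q).map fun r => Apr.getD ((q - r) % q) 0)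
  let c0 := enc X ((List.range q).map fun r => Cpr.getD (r % q) 0)
  let XQ := X ^ (q - 1)
  let rowsA := (List.range q).foldl (fun (acc : List ℕ × ℕ) i =>
      (acc.1 ++ [acc.2], Apr.getD ((i + 1) % q) 0 + X * (acc.2 % XQ))) ([], a0)
  let rowsC := (List.range q).foldl (fun (acc : List ℕ × ℕ) i =>
      (acc.1 ++ [acc.2], (acc.2 - Cpr.getD (i % q) 0) / X + Cpr.getD (i % q) 0 * XQ)) ([], c0)
  (List.range q).map fun i => rowsA.1.getD i 0 + rowsC.1.getD i 0

/-- Packed `B·M` check: `S_i = Σ_r (digit_r β_i mod N)·RP r` is the packed row `i` of `B·M`; its digits mod `N` must be `δ_i`.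
[folklore] -/
def invChkQ (q N X : ℕ) (β RP : List ℕ) : Bool :=
  (List.range q).all fun i =>
    let S := dot ((List.range q).map fun r => digit X (β.getD i 0) r % N) RP
    (List.range q).all fun j => digit X S j % N == (if i = j then 1 % N else 0)

/-- Row sums of the candidate inverse (mod `N`) from its packed rows. [folklore] -/
def rowSumsP (q N X : ℕ) (β : List ℕ) : List ℕ :=
  (List.range q).map fun i => ((List.range q).map fun r => digit X (β.getD i 0) r % N).sum % N

/-- Candidate solution for hole `s` from packed rows: `y_s(i) = (K·R_i + (N − B(i,s) mod N)) mod N`. [folklore] -/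
def ycandP (q N K X : ℕ) (β R : List ℕ) (s : ℕ) : List ℕ :=
  (List.range q).map fun i => (K * R.getD i 0 + (N - digit X (β.getD i 0) s % N % N)) % N

/-- Hole refutation from packed rows (verification branch with the honest `rows`, rarely reached). [folklore] -/
def holeRefutedP (q N K e X : ℕ) (M : List (List ℕ)) (β R : List ℕ) (s : ℕ) : Bool :=
  let y := ycandP q N K X β R s
  (y.any fun v => decide (e < v)) || !((List.range q).all fun r => dot (M.getD r []) y == (bvec q K s).getD r 0)

/-- **Fast inverse certificate check** (`b` = digit width in bits; `ZR = zrows q N ζ (2^b)` precomputed for a `q`-th root of unity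
`ζ` mod the prime `N` — it only feeds the unverified candidate). [folklore] -/
def noSol3ChkQ (q N K e b : ℕ) (ZR : List ℕ) (W F : List ℕ) : Bool :=
  let X := 2 ^ b
  let pA := enc X (acoef q W F)
  let pC := enc X (ccoef q W F)
  let RP := rowpacksD q X pA pC
  let β := invCandP q N X ZR W F
  let R := rowSumsP q N X β
  decide (e < N) && decide (q * N * (3 * W.sum * F.sum) < X) && invChkQ q N X β RP &&
    (List.range q).all fun s => holeRefutedP q N K e X (rows q W F) β R s

/-! ## Lemmas on packing -/

/-- Digits of a packed list with entries `< X` are its entries. [folklore] -/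
theorem digit_enc {X : ℕ} (hX : 0 < X) : ∀ (l : List ℕ) (j : ℕ), (∀ a ∈ l, a < X) → digit X (enc X l) j = l.getD j 0
  | [], j, _ => by simp [digit, enc, Nat.zero_div]
  | a :: l, 0, h => by
    have ha : a < X := h a (by simp)
    simp only [digit, enc, pow_zero, Nat.div_one, List.getD_cons_zero]
    rw [Nat.add_mul_mod_self_left, Nat.mod_eq_of_lt ha]
  | a :: l, j + 1, h => by
    have ha : a < X := h a (by simp)
    have ih := digit_enc hX l j (fun b hb => h b (by simp [hb]))
    simp only [digit, enc, List.getD_cons_succ] at ih ⊢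
    rw [pow_succ', ← Nat.div_div_eq_div_mul, Nat.add_mul_div_left _ _ hX, Nat.div_eq_of_lt ha, zero_add]
    exact ih

/-- Packing is additive on `map`s over one list. [folklore] -/
theorem enc_map_add (X : ℕ) (f g : ℕ → ℕ) : ∀ L : List ℕ,
    enc X (L.map fun j => f j + g j) = enc X (L.map f) + enc X (L.map g)
  | [] => rfl
  | a :: L => by simp only [List.map_cons, enc]; rw [enc_map_add X f g L]; ring

/-- Packing is homogeneous. [folklore] -/
theorem enc_map_smul (X c : ℕ) (f : ℕ → ℕ) : ∀ L : List ℕ, enc X (L.map fun j => c * f j) = c * enc X (L.map f)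
  | [] => by simp [enc]
  | a :: L => by simp only [List.map_cons, enc]; rw [enc_map_smul X c f L]; ring

/-- Packing the zero vector. [folklore] -/
theorem enc_map_zero (X : ℕ) : ∀ L : List ℕ, enc X (L.map fun _ => 0) = 0
  | [] => rfl
  | a :: L => by simp only [List.map_cons, enc]; rw [enc_map_zero X L]; ring

/-- **Packing is linear**: `Σ_{r<n} c_r · enc(row_r) = enc(Σ_{r<n} c_r • row_r)`. [folklore] -/
theorem sum_mul_enc (X : ℕ) (L : List ℕ) (c : ℕ → ℕ) (row : ℕ → ℕ → ℕ) : ∀ n : ℕ,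
    ∑ r ∈ Finset.range n, c r * enc X (L.map (row r)) = enc X (L.map fun j => ∑ r ∈ Finset.range n, c r * row r j)
  | 0 => by
    rw [Finset.sum_range_zero, show (L.map fun j => ∑ r ∈ Finset.range 0, c r * row r j) = L.map (fun _ => 0) from
      List.map_congr_left (fun j _ => by simp), enc_map_zero]
  | n + 1 => by
    rw [Finset.sum_range_succ, sum_mul_enc X L c row n]
    have e1 : (L.map fun j => ∑ r ∈ Finset.range (n + 1), c r * row r j) =
        L.map fun j => (∑ r ∈ Finset.range n, c r * row r j) + c n * row n j :=
      List.map_congr_left fun j _ => Finset.sum_range_succ _ _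
    rw [e1, enc_map_add, enc_map_smul]

/-- An entry of a list of naturals is at most its sum. [folklore] -/
theorem getD_le_sum : ∀ (l : List ℕ) (i : ℕ), l.getD i 0 ≤ l.sum
  | [], i => by simp
  | a :: l, 0 => by simp
  | a :: l, i + 1 => by
    rw [List.getD_cons_succ, List.sum_cons]
    exact (getD_le_sum l i).trans (Nat.le_add_left _ _)

/-- `dot (map f (range n)) l = Σ_{r<n} f r · l[r]`. [folklore] -/
theorem dot_map_range_left (f : ℕ → ℕ) (n : ℕ) (l : List ℕ) :
    dot ((List.range n).map f) l = ∑ r ∈ Finset.range n, f r * l.getD r 0 := by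
  induction n generalizing l f with
  | zero => cases l <;> rfl
  | succ n ih =>
    rw [List.range_succ_eq_map, List.map_cons, List.map_map, Finset.sum_range_succ']
    cases l with
    | nil =>
      show 0 = _
      simp
    | cons a l =>
      show f 0 * a + dot ((List.range n).map (f ∘ Nat.succ)) l = _
      rw [ih (l := l) (f := f ∘ Nat.succ), add_comm]
      rfl

/-- Entries of the circulant symbol are bounded by `2·ΣW·ΣF`. [folklore] -/
theorem acoef_getD_le (q : ℕ) (W F : List ℕ) (t : ℕ) : (acoef q W F).getD t 0 ≤ 2 * W.sum * F.sum := by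
  by_cases ht : t < q
  · unfold acoef
    rw [getD_range_map _ ht, sum_range_map]
    calc ∑ v ∈ Finset.range q, W.getD v 0 * (F.getD ((t + v) % q) 0 + F.getD ((v + q - t) % q) 0)
        ≤ ∑ v ∈ Finset.range q, W.getD v 0 * (2 * F.sum) :=
          Finset.sum_le_sum fun v _ => Nat.mul_le_mul_left _ (by have := getD_le_sum F ((t + v) % q); have := getD_le_sum F ((v + q - t) % q); omega)
      _ = (∑ v ∈ Finset.range q, W.getD v 0) * (2 * F.sum) := by rw [Finset.sum_mul]
      _ ≤ W.sum * (2 * F.sum) := Nat.mul_le_mul_right _ (by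
          rw [← sum_range_map]
          have : ((List.range q).map fun v => W.getD v 0).sum ≤ W.sum := by
            calc ((List.range q).map fun v => W.getD v 0).sum
                = ∑ v ∈ Finset.range q, W.getD v 0 := sum_range_map _ _
              _ ≤ ∑ v ∈ Finset.range W.length, W.getD v 0 := by
                  rcases le_or_gt q W.length with h | h
                  · exact Finset.sum_le_sum_of_subset (Finset.range_mono h)
                  · rw [← Finset.sum_range_add_sum_Ico _ h.le]
                    have : ∑ v ∈ Finset.Ico W.length q, W.getD v 0 = 0 :=
                      Finset.sum_eq_zero fun v hv => List.getD_eq_default _ _ (Finset.mem_Ico.1 hv).1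
                    omega
              _ = W.sum := (sum_eq_sum_getD W).symm
          exact this)
      _ = 2 * W.sum * F.sum := by ring
  · rw [List.getD_eq_default _ _ (by unfold acoef; simp; omega)]; exact Nat.zero_le _

/-- Entries of the Hankel symbol are bounded by `ΣW·ΣF`. [folklore] -/
theorem ccoef_getD_le (q : ℕ) (W F : List ℕ) (t : ℕ) : (ccoef q W F).getD t 0 ≤ W.sum * F.sum := by
  by_cases ht : t < q
  · unfold ccoef
    rw [getD_range_map _ ht, sum_range_map]
    calc ∑ v ∈ Finset.range q, W.getD v 0 * F.getD ((t + q - v) % q) 0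
        ≤ ∑ v ∈ Finset.range q, W.getD v 0 * F.sum := Finset.sum_le_sum fun v _ => Nat.mul_le_mul_left _ (getD_le_sum F _)
      _ = (∑ v ∈ Finset.range q, W.getD v 0) * F.sum := by rw [Finset.sum_mul]
      _ ≤ W.sum * F.sum := Nat.mul_le_mul_right _ (by
          calc ∑ v ∈ Finset.range q, W.getD v 0
              ≤ ∑ v ∈ Finset.range W.length, W.getD v 0 := by
                rcases le_or_gt q W.length with h | h
                · exact Finset.sum_le_sum_of_subset (Finset.range_mono h)
                · rw [← Finset.sum_range_add_sum_Ico _ h.le]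
                  have : ∑ v ∈ Finset.Ico W.length q, W.getD v 0 = 0 :=
                    Finset.sum_eq_zero fun v hv => List.getD_eq_default _ _ (Finset.mem_Ico.1 hv).1
                  omega
            _ = W.sum := (sum_eq_sum_getD W).symm)
  · rw [List.getD_eq_default _ _ (by unfold ccoef; simp; omega)]; exact Nat.zero_le _

/-! ## Soundness -/

section Sound

variable {q : ℕ} [NeZero q]

/-- **Soundness of the fast inverse certificate** (same statement as `noSol3Chk_sound`). [folklore] -/
theorem noSol3ChkQ_sound {N K e b : ℕ} {ZR W F : List ℕ} (h : noSol3ChkQ q N K e b ZR W F = true)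
    (G : ZMod q → ℕ) (s : ZMod q) (hG : ∀ u, G u ≤ e)
    (hid : ∀ τ : ZMod q, (∑ u : ZMod q, lineMat3 (vecFn W) (vecFn F) τ u * G u) + (if s = τ then 1 else 0) = K) :
    False := by
  have hq : 0 < q := Nat.pos_of_ne_zero (NeZero.ne q)
  -- unpack the check
  unfold noSol3ChkQ at h
  simp only [Bool.and_eq_true, decide_eq_true_eq, List.all_eq_true, List.mem_range] at h
  obtain ⟨⟨⟨heN, hbound⟩, hinv⟩, hholes⟩ := h
  set X := 2 ^ b with hXdef
  have hX : 0 < X := by rw [hXdef]; positivity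
  set pA := enc X (acoef q W F) with hpA
  set pC := enc X (ccoef q W F) with hpC
  set β := invCandP q N X ZR W F with hβ
  set R := rowSumsP q N X β with hR
  have hNpos : 0 < N := by omega
  -- entry bounds
  have hM3 : q * N * (3 * W.sum * F.sum) < X := hbound
  have hqN : 0 < q * N := Nat.mul_pos hq hNpos
  have h3lt : 3 * W.sum * F.sum < X := lt_of_le_of_lt (Nat.le_mul_of_pos_left _ hqN) hM3
  have h2le3 : 2 * W.sum * F.sum ≤ 3 * W.sum * F.sum := Nat.mul_le_mul_right _ (Nat.mul_le_mul_right _ (by norm_num))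
  have h1le3 : W.sum * F.sum ≤ 3 * W.sum * F.sum := by
    rw [mul_assoc]; exact Nat.le_mul_of_pos_left _ (by norm_num)
  have hAdig : ∀ t, digit X pA t = (acoef q W F).getD t 0 := fun t =>
    digit_enc hX _ t fun a ha => by
      obtain ⟨i, hi, rfl⟩ := List.getElem_of_mem ha
      have h0 := acoef_getD_le q W F i
      rw [List.getD_eq_getElem _ _ hi] at h0
      exact lt_of_le_of_lt (h0.trans h2le3) h3lt
  have hCdig : ∀ t, digit X pC t = (ccoef q W F).getD t 0 := fun t =>
    digit_enc hX _ t fun a ha => by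
      obtain ⟨i, hi, rfl⟩ := List.getElem_of_mem ha
      have h0 := ccoef_getD_le q W F i
      rw [List.getD_eq_getElem _ _ hi] at h0
      exact lt_of_le_of_lt (h0.trans h1le3) h3lt
  have hmfun_le : ∀ r j, mfun q W F r j ≤ 3 * W.sum * F.sum := fun r j => by
    unfold mfun
    calc (acoef q W F).getD ((r + q - j) % q) 0 + (ccoef q W F).getD ((r + j) % q) 0
        ≤ 2 * W.sum * F.sum + W.sum * F.sum := Nat.add_le_add (acoef_getD_le q W F _) (ccoef_getD_le q W F _)
      _ = 3 * W.sum * F.sum := by ring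
  -- notation: `g u = G ↑u`, the hole index `sv`, and `K = K' + 1`
  have hgle : ∀ u : ℕ, G (u : ZMod q) ≤ e := fun u => hG _
  set sv := s.val with hsv
  have hsv_lt : sv < q := ZMod.val_lt s
  have hK1 : 1 ≤ K := by have := hid s; simp at this; omega
  obtain ⟨K', rfl⟩ : ∃ K', K = K' + 1 := ⟨K - 1, by omega⟩
  -- (1) the system in pure-ℕ form
  have hsys : ∀ r, r < q → ∑ u ∈ Finset.range q, mfun q W F r u * G (u : ZMod q) = (if r = sv then K' else K' + 1) := by
    intro r hr
    have h0 := hid (r : ZMod q)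
    rw [sum_lineMat3_eq, ZMod.val_natCast, Nat.mod_eq_of_lt hr] at h0
    have hiff : (s = (r : ZMod q)) ↔ r = sv := by
      constructor
      · intro e; rw [hsv, e, ZMod.val_natCast, Nat.mod_eq_of_lt hr]
      · intro e; rw [e, hsv, ZMod.natCast_zmod_val]
    by_cases hrs : r = sv
    · rw [if_pos (hiff.2 hrs)] at h0; rw [if_pos hrs]; omega
    · rw [if_neg (fun e => hrs (hiff.1 e))] at h0; rw [if_neg hrs]; omega
  -- the candidate inverse as a function: `Bf i r = digit_r(β_i) mod N`
  set Bf : ℕ → ℕ → ℕ := fun i r => digit X (β.getD i 0) r % N with hBf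
  have hBf_lt : ∀ i r, Bf i r < N := fun i r => Nat.mod_lt _ hNpos
  -- (2) `B·M ≡ I (mod N)` from the packed check
  have hRP : ∀ r, r < q → (rowpacksD q X pA pC).getD r 0 = enc X ((List.range q).map (mfun q W F r)) := by
    intro r hr
    unfold rowpacksD
    rw [getD_range_map _ hr]
    congr 1
    refine List.map_congr_left fun j _ => ?_
    rw [hAdig, hCdig]; rfl
  have hBM : ∀ i j, i < q → j < q →
      (∑ r ∈ Finset.range q, Bf i r * mfun q W F r j) % N = if i = j then 1 % N else 0 := by
    intro i j hi hj
    have h0 := hinv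
    unfold invChkQ at h0
    simp only [List.all_eq_true, List.mem_range, beq_iff_eq] at h0
    have h1 := h0 i hi j hj
    -- the packed row `S_i`
    rw [dot_map_range_left] at h1
    have hS : ∑ r ∈ Finset.range q, (digit X (β.getD i 0) r % N) * (rowpacksD q X pA pC).getD r 0 =
        enc X ((List.range q).map fun j => ∑ r ∈ Finset.range q, Bf i r * mfun q W F r j) := by
      rw [← sum_mul_enc X (List.range q) (Bf i) (fun r j => mfun q W F r j) q]
      exact Finset.sum_congr rfl fun r hr => by rw [hRP r (Finset.mem_range.1 hr)]
    rw [hS, digit_enc hX _ j ?_, getD_range_map _ hj] at h1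
    · exact h1
    · intro a ha
      obtain ⟨j', hj', rfl⟩ := mem_range_map ha
      calc ∑ r ∈ Finset.range q, Bf i r * mfun q W F r j'
          ≤ ∑ r ∈ Finset.range q, N * (3 * W.sum * F.sum) :=
            Finset.sum_le_sum fun r _ => Nat.mul_le_mul (hBf_lt i r).le (hmfun_le r j')
        _ = q * N * (3 * W.sum * F.sum) := by rw [Finset.sum_const, Finset.card_range, smul_eq_mul]; ring
        _ < X := hM3
  -- (3) the residue solution equals `G`
  have hRi : ∀ i, i < q → R.getD i 0 = (∑ r ∈ Finset.range q, Bf i r) % N := by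
    intro i hi
    rw [hR]; unfold rowSumsP
    rw [getD_range_map _ hi, sum_range_map]
  have hyc : ∀ i, i < q → ((K' + 1) * R.getD i 0 + (N - digit X (β.getD i 0) sv % N % N)) % N = G (i : ZMod q) := by
    intro i hi
    set S := ∑ r ∈ Finset.range q, Bf i r with hS
    have hb : Bf i sv ≤ S := Finset.single_le_sum (f := fun r => Bf i r) (fun _ _ => Nat.zero_le _)
      (Finset.mem_range.2 hsv_lt)
    have eBsv : digit X (β.getD i 0) sv % N = Bf i sv := rfl
    rw [hRi i hi, eBsv, ycand_congr hb (Nat.succ_le_succ (Nat.zero_le K')) hNpos]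
    have e1 : (K' + 1) * S - Bf i sv = ∑ r ∈ Finset.range q, Bf i r * (if r = sv then K' else K' + 1) := by
      have h2 : ∑ r ∈ Finset.range q, Bf i r * (if r = sv then K' else K' + 1) + Bf i sv = (K' + 1) * S := by
        rw [hS, Finset.mul_sum, ← Finset.sum_erase_add _ _ (Finset.mem_range.2 hsv_lt),
          ← Finset.sum_erase_add (Finset.range q) _ (Finset.mem_range.2 hsv_lt), if_pos rfl, add_assoc]
        congr 1
        · exact Finset.sum_congr rfl fun r hr => by rw [if_neg (Finset.ne_of_mem_erase hr)]; ring
        · ring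
      omega
    rw [e1]
    have e2 : ∑ r ∈ Finset.range q, Bf i r * (if r = sv then K' else K' + 1) =
        ∑ u ∈ Finset.range q, G (u : ZMod q) * ∑ r ∈ Finset.range q, Bf i r * mfun q W F r u := by
      rw [Finset.sum_congr rfl fun r hr => by rw [← hsys r (Finset.mem_range.1 hr), Finset.mul_sum], Finset.sum_comm]
      exact Finset.sum_congr rfl fun u _ => by rw [Finset.mul_sum]; exact Finset.sum_congr rfl fun r _ => by ring
    rw [e2, Finset.sum_nat_mod, Finset.sum_congr rfl fun u hu => by
      rw [Nat.mul_mod, hBM i u hi (Finset.mem_range.1 hu)]]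
    rw [← Finset.sum_nat_mod]
    have e3 : ∑ u ∈ Finset.range q, G (u : ZMod q) % N * (if i = u then 1 % N else 0) = G (i : ZMod q) % N * (1 % N) := by
      rw [Finset.sum_eq_single i (fun u _ hui => by rw [if_neg (Ne.symm hui), mul_zero])
        (fun hi' => absurd (Finset.mem_range.2 hi) hi'), if_pos rfl]
    rw [e3, ← Nat.mul_mod, mul_one, Nat.mod_eq_of_lt (lt_of_le_of_lt (hgle i) heN)]
  -- (4) the hole `sv` is refuted — contradiction
  have hh := hholes sv hsv_lt
  have hall : ((List.range q).all fun r =>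
      dot ((rows q W F).getD r []) (ycandP q N (K' + 1) X β R sv) == (bvec q (K' + 1) sv).getD r 0) = true := by
    rw [List.all_eq_true]
    intro r hr
    rw [List.mem_range] at hr
    rw [beq_iff_eq]
    unfold rows bvec
    rw [getD_range_map _ hr, getD_range_map _ hr, Nat.add_sub_cancel]
    unfold ycandP
    rw [dot_range_map, ← hsys r hr]
    refine Finset.sum_congr rfl fun u hu => ?_
    rw [getD_range_map _ (Finset.mem_range.1 hu), hyc u (Finset.mem_range.1 hu)]
  have hany : ((ycandP q N (K' + 1) X β R sv).any fun v => decide (e < v)) = false := by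
    rw [List.any_eq_false]
    intro v hv
    unfold ycandP at hv
    obtain ⟨i, hi, rfl⟩ := mem_range_map hv
    rw [decide_eq_true_eq, not_lt, hyc i hi]
    exact hgle i
  unfold holeRefutedP at hh
  dsimp only at hh
  rw [hany, hall] at hh
  exact Bool.noConfusion hh

end Sound

end LineInv

end Summit.MatrixMultiplication.OmegaCensus
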